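import Summits.NavierStokesRegularity.NavierStokesRegularity.Theses.TerminalTrace
import Summits.NavierStokesRegularity.NavierStokesRegularity.Theorems.TerminalTraceTypeITraceScarL3OfNoSpreadExtinctApex
import Summits.NavierStokesRegularity.NavierStokesRegularity.Theorems.TerminalTraceTypeITraceScarL3SqrtTwoApexWindow
import Summits.NavierStokesRegularity.NavierStokesRegularity.Theorems.TerminalTraceTypeITraceScarL3RadiusDichotomy
import Summits.NavierStokesRegularity.NavierStokesRegularity.Theorems.TerminalTraceTypeITraceScarL3LateBoundedLiouville
import Summits.NavierStokesRegularity.NavierStokesRegularity.Theorems.TerminalTraceTypeITraceScarL3CaseTwoZoom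
import Summits.NavierStokesRegularity.NavierStokesRegularity.Theorems.TerminalTraceTypeITraceScarL3HalfSpaceLiouville
import Summits.NavierStokesRegularity.NavierStokesRegularity.Theorems.TerminalTraceTypeITraceScarL3CaseOneZoom
import Literature.Analysis.FluidPDE.LocalTypeI
import HarnessLib

/-!
# LINE `radius-dichotomy` (skeleton v6 — v5 REGISTERED 14:21Z, v5.1 RE-REGISTERED 14:38Z by nsreg-p2 g33; v6 = ALL FIVE STUBS FILLED by landed theorems (Z1 p640974 / Z2 p644035 / Z3 p639821 / Z4 `caseOneZoom` / Z5 p642950); sorries = 0; the composition closes the item BY NAME — for item stmt-NavierStokesRegularity-18385 `TerminalTrace.TypeITraceScarL3`;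
# nsreg-C26-p1 g5, 2026-08-28; memo HOME/nsreg-C26-p1-LOUD-ZOOM-18385.md 26a174b12455e268) — NOT REGISTERED (registry
# verbs are the planner's / LEAD's); every `sorry` below sits in a `stub_*`; the composition is kernel-checked.

THESIS. The item's original paper route («extinction Liouville in the class via a second zoom at the point of the top
singular set nearest a regular point + ESS half-space backward uniqueness») closes once the UNIFORMITY GAP at the nearest
point is closed by a REGULARITY-RADIUS DICHOTOMY. With `Adm U y r :⇔ ‖U‖ ≤ r⁻¹ a.e. on Q_r(0,y)` (scale-invariant L^∞
regularity radius; bounds come for free) and `Σ₀ = {x | (0,x) backward singular}`: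
* Z3 `stub_radiusDichotomy` (S, pure analysis on `U`): EITHER the radius is comparable to the distance to `Σ₀`
  (CASE 2: `Adm U y r` for all `r ≤ c₀·min(dist(y,Σ₀),1)`, `y` regular) OR for every `A` there is a point `yc` and a
  radius `r ≤ 1/2` with `Adm U y' (r/4)` on `B(yc, A r)` and `¬ Adm U yc (2r)` (CASE 1; inf/compactness argument).
* Z4 `stub_caseOneZoom` (L): in CASE 1 the zooms `r_k U(r_k² s, yc_k + r_k y)`, `A_k → ∞`, converge (AB19 compactness
  `SuitableCompactness_holds`; class heredity `LocalTypeIReverseZoom`, `…ApexPackageTranslate`; bounds by `LocalTypeILsc*`;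
  top-vanishing by the UNIFORM pairing modulus `exists_uniform_pairing_modulus_of_bounds`) to a class member bounded by `4`
  a.e. on the late WHOLE-SPACE slab `]−1/16, 0[ × ℝ³` and NON-TRIVIAL on `Q_3(0)` (uniform Serrin/Hölder bounds
  `exists_representative_of_ae_bound_of_local_pressure` turn `¬ Adm(2r)` into `L³` mass).
* Z1 `stub_lateBoundedLiouville` (M): a class member that is a.e. bounded on a late whole-space slab VANISHES on every
  `Q_a(0)`: the rate bounds the earlier times, the TREE's ESS endgame `ancient_lintegral_cube_eq_zero_of_farField_le` at
  every top apex (translation heredity) clears a slab `]−λ²/4, 0[`, and time shifts (top-vanishing at the new apex from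
  the uniform pairing modulus) iterate to any depth; slice Liouville from the rate + `cknAEss ≤ 𝐈`
  (`harmonic_eq_zero_of_ae_bounded_of_energy_growth`).
* Z5 `stub_caseTwoZoom` (L): in CASE 2, with a regular top point `y₁` (exists: `μH[1] Σ₀ = 0`,
  `hausdorffMeasure_topSingular_apex_eq_zero`) and `x* ∈ Σ₀` nearest to it, the zooms at `(0,x*)` converge to a class
  member a.e. bounded on the late HALF-SPACE slab `]−δ,0[ × {⟨y,e⟩ > 1}` (explicit geometry of the clean ball, memo §3(a))
  and NON-TRIVIAL on `Q_1(0)` (Seregin's floor `exists_le_cknC_of_isBackwardSingularPoint` + strong `L³`).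
* Z2 `stub_halfSpaceLiouville` (L): a class member a.e. bounded on a late half-space slab VANISHES on every `Q_a(0)`:
  half-space representative, the TREE's `farField_curl_eq_zero_halfSpace`, the strip step of `AncientLimitVanishing`
  with the far region a half-space (strips are bounded BY THE RATE — no CKN regular times), slice Liouville, then Z1.
* composition `no_singular_extinctApex` (kernel-checked): NO extinct Type-I apex is backward-singular at the origin —
  hence Stub C / LOUD / QA and the ITEM by name via the landed `typeITraceScarL3_of_no_spreadExtinctApex` (p585751).
Backward uniqueness is used ONLY where the flow is uniformly regular up to the top (bounded coefficients): the refuter's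
`abstractBUTypeIZeroOrder_false` is not met. The LOUD hypothesis is not used.
HONEST FRAME: a candidate skeleton with five open stubs; 18385 and NS regularity are NOT proved here.
-/

set_option linter.dupNamespace false

noncomputable section

open MeasureTheory Set Function Filter Topology Metric
open scoped NNReal ENNReal InnerProductSpace RealInnerProductSpace

namespace Summit.NavierStokesRegularity.NavierStokesRegularity.Cruxes.TypeITraceScarL3.RadiusDichotomy

open Literature.Analysis.FluidPDE
open Summit.NavierStokesRegularity.NavierStokesRegularity.Theorems.TypeITraceScarL3

/-- STUB Z3 «RADIUS DICHOTOMY» — FILLED (p639821 `…Theorems.TypeITraceScarL3.radiusDichotomy`) — (S; pure real analysis, no PDE): for ANY field `U`, either the scale-invariant `L^∞`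
regularity radius at the top time is comparable to the distance to the top singular set at every regular top point
(CASE 2), or at every magnification `A` some point `yc` carries a radius `r ≤ 1/2` that is admissible up to `r/4` on the
whole ball `B(yc, A r)` but NOT admissible at `2r` at `yc` itself (CASE 1). Proof: let `ρ(y) = sup` of admissible radii
`≤ 1`; admissible radii form an initial segment; `ρ > 0` near every regular top point with a local uniform lower bound
(`Q_{r'}(0,y') ⊆ Q_r(0,y)`); if CASE 2 fails with constant `1/(8A)` at a regular `y` (so `d = dist(y,Σ₀) > 0`), minimise
`Φ(y') = ρ(y')/(d/2 − |y' − y|)` over `B(y, d/2)` up to a factor `3/2` (the infimum is positive by compactness of the closed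
ball and the local lower bound) and take `r = ρ(yc)` at a near-minimiser `yc`. -/
theorem stub_radiusDichotomy :
    ∀ (U : ℝ → EuclideanSpace ℝ (Fin 3) → EuclideanSpace ℝ (Fin 3)),
    (∃ c₀ : ℝ, 0 < c₀ ∧ ∀ y : EuclideanSpace ℝ (Fin 3),
        ¬ IsBackwardSingularPoint U ((0 : ℝ), y) →
        ∀ r : ℝ, 0 < r →
          r ≤ c₀ * min (infDist y {x : EuclideanSpace ℝ (Fin 3) | IsBackwardSingularPoint U ((0 : ℝ), x)}) 1 →
          ∀ᵐ z ∂(volume.restrict (parabolicCylinder r (((0 : ℝ), y) : ℝ × EuclideanSpace ℝ (Fin 3)))),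
            ‖U z.1 z.2‖ ≤ r⁻¹) ∨
    (∀ A : ℝ, 0 < A → ∃ (yc : EuclideanSpace ℝ (Fin 3)) (r : ℝ), 0 < r ∧ r ≤ 1 / 2 ∧
        (∀ y' ∈ ball yc (A * r),
          ∀ᵐ z ∂(volume.restrict (parabolicCylinder (r / 4) (((0 : ℝ), y') : ℝ × EuclideanSpace ℝ (Fin 3)))),
            ‖U z.1 z.2‖ ≤ (r / 4)⁻¹) ∧
        ¬ (∀ᵐ z ∂(volume.restrict (parabolicCylinder (2 * r) (((0 : ℝ), yc) : ℝ × EuclideanSpace ℝ (Fin 3)))),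
            ‖U z.1 z.2‖ ≤ (2 * r)⁻¹)) := by
  exact radiusDichotomy

/-- STUB Z1 «LATE-BOUNDED LIOUVILLE» — FILLED (p640974 `…Theorems.TypeITraceScarL3.lateBoundedLiouville`; tools p640096, p640578) — (M): an extinct Type-I apex of the class which is a.e. bounded on a late WHOLE-SPACE
slab `]−δ, 0[ × ℝ³` vanishes a.e. on every parabolic ball `Q_a(0)`. Proof: the rate bounds `]−3a², −δ]`, so `U` is a.e.
bounded on `]−3a², 0[ × ℝ³` by some `L`; the tree's ESS endgame `ancient_lintegral_cube_eq_zero_of_farField_le` at every top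
apex `(0, x₀)` (space-translation heredity of the class, `…ApexPackageTranslate`; slice Liouville from the rate and
`cknAEss ≤ 𝐈`, `harmonic_eq_zero_of_ae_bounded_of_energy_growth`) clears `]−λ²/4, 0[ × ℝ³`, `λ = min(1, 1/L)`; shifting the
apex to `s₁ = −λ²/8` (top-vanishing there from the uniform pairing modulus `exists_uniform_pairing_modulus_of_bounds` and
the cleared slab; the other clauses restrict) and iterating `⌈24 a² L²⌉` times clears `Q_a(0)`. -/
theorem stub_lateBoundedLiouville :
    ∀ (U : ℝ → EuclideanSpace ℝ (Fin 3) → EuclideanSpace ℝ (Fin 3))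
      (P : ℝ → EuclideanSpace ℝ (Fin 3) → ℝ)
      (G : ℝ → EuclideanSpace ℝ (Fin 3) →
        EuclideanSpace ℝ (Fin 3) →L[ℝ] EuclideanSpace ℝ (Fin 3))
      (M D₀ : ℝ≥0) (C : ℝ),
      (∀ a : ℝ, 0 < a →
        IsSuitableWeakSolutionInBall a (0 : ℝ × EuclideanSpace ℝ (Fin 3)) U P) →
      (∀ a : ℝ, 0 < a →
        HasWeakSpatialGradientOn
          (parabolicCylinderOpens a (0 : ℝ × EuclideanSpace ℝ (Fin 3))) U G) →
      (∀ a : ℝ, 0 < a →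
        typeIBound (parabolicCylinder a (0 : ℝ × EuclideanSpace ℝ (Fin 3))) U P G ≤ M) →
      (∀ z₀ : ℝ × EuclideanSpace ℝ (Fin 3), z₀.1 ≤ 0 →
        ∀ r : ℝ, 0 < r → cknD r z₀ P ≤ D₀) →
      (∀ s : ℝ, s < 0 →
        ∀ᵐ y : EuclideanSpace ℝ (Fin 3), ‖U s y‖ ≤ C / Real.sqrt (-s)) →
      (∀ φ : EuclideanSpace ℝ (Fin 3) → EuclideanSpace ℝ (Fin 3),
        ContDiff ℝ (⊤ : ℕ∞) φ →
        HasCompactSupport φ → ∀ ε : ℝ, 0 < ε →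
        ∃ s₀ : ℝ, s₀ < 0 ∧ ∀ᵐ s ∂(volume.restrict (Ioo s₀ 0)), |∫ y, ⟪U s y, φ y⟫| ≤ ε) →
      (∃ δ : ℝ, 0 < δ ∧ ∃ K : ℝ,
        ∀ᵐ z ∂(volume.restrict (Ioo (-δ) 0 ×ˢ (univ : Set (EuclideanSpace ℝ (Fin 3))))),
          ‖U z.1 z.2‖ ≤ K) →
      ∀ a : ℝ, 0 < a →
        ∀ᵐ z ∂(volume.restrict (parabolicCylinder a (0 : ℝ × EuclideanSpace ℝ (Fin 3)))), U z.1 z.2 = 0 := by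
  exact lateBoundedLiouville

/-- STUB Z2 «HALF-SPACE LIOUVILLE» (L): an extinct Type-I apex of the class which is a.e. bounded on a late HALF-SPACE
slab `]−δ, 0[ × {⟨y, e⟩ > 1}` (`‖e‖ = 1`) vanishes a.e. on every `Q_a(0)`. Proof (normalise `δ ↦ 1` by scaling): the
half-space representative with derivative bounds (`exists_representative_of_ae_bound_of_local_pressure`), the tree's
`farField_curl_eq_zero_halfSpace` (`w := U·𝟙`, which carries the top-vanishing the theorem needs), the strip step of
`AncientLimitVanishing` with the far region a half-space (every strip `]a,b[`, `b < 0`, is a.e. bounded BY THE RATE;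
`Carleman.uniqueContinuation_uncurried_c12` across balls centred deep in the half-space; div-free + curl-free ⇒ harmonic;
slice Liouville) gives `U = 0` a.e. on `]−δ,0[ × ℝ³`, then `stub_lateBoundedLiouville`. -/
theorem stub_halfSpaceLiouville :
    ∀ (U : ℝ → EuclideanSpace ℝ (Fin 3) → EuclideanSpace ℝ (Fin 3))
      (P : ℝ → EuclideanSpace ℝ (Fin 3) → ℝ)
      (G : ℝ → EuclideanSpace ℝ (Fin 3) →
        EuclideanSpace ℝ (Fin 3) →L[ℝ] EuclideanSpace ℝ (Fin 3))
      (M D₀ : ℝ≥0) (C : ℝ),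
      (∀ a : ℝ, 0 < a →
        IsSuitableWeakSolutionInBall a (0 : ℝ × EuclideanSpace ℝ (Fin 3)) U P) →
      (∀ a : ℝ, 0 < a →
        HasWeakSpatialGradientOn
          (parabolicCylinderOpens a (0 : ℝ × EuclideanSpace ℝ (Fin 3))) U G) →
      (∀ a : ℝ, 0 < a →
        typeIBound (parabolicCylinder a (0 : ℝ × EuclideanSpace ℝ (Fin 3))) U P G ≤ M) →
      (∀ z₀ : ℝ × EuclideanSpace ℝ (Fin 3), z₀.1 ≤ 0 →
        ∀ r : ℝ, 0 < r → cknD r z₀ P ≤ D₀) →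
      (∀ s : ℝ, s < 0 →
        ∀ᵐ y : EuclideanSpace ℝ (Fin 3), ‖U s y‖ ≤ C / Real.sqrt (-s)) →
      (∀ φ : EuclideanSpace ℝ (Fin 3) → EuclideanSpace ℝ (Fin 3),
        ContDiff ℝ (⊤ : ℕ∞) φ →
        HasCompactSupport φ → ∀ ε : ℝ, 0 < ε →
        ∃ s₀ : ℝ, s₀ < 0 ∧ ∀ᵐ s ∂(volume.restrict (Ioo s₀ 0)), |∫ y, ⟪U s y, φ y⟫| ≤ ε) →
      (∃ e : EuclideanSpace ℝ (Fin 3), ‖e‖ = 1 ∧ ∃ δ : ℝ, 0 < δ ∧ ∃ K : ℝ,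
        ∀ᵐ z ∂(volume.restrict (Ioo (-δ) 0 ×ˢ {y : EuclideanSpace ℝ (Fin 3) | 1 < ⟪y, e⟫})),
          ‖U z.1 z.2‖ ≤ K) →
      ∀ a : ℝ, 0 < a →
        ∀ᵐ z ∂(volume.restrict (parabolicCylinder a (0 : ℝ × EuclideanSpace ℝ (Fin 3)))), U z.1 z.2 = 0 := by
  exact halfSpaceLiouville

/-- STUB Z4 «CASE-1 ZOOM PACKAGE» (L): from the CASE-1 data of `stub_radiusDichotomy` an extinct Type-I apex produces, by
zooming at `(0, yc_k)` with scale `r_k` along `A_k → ∞` (class heredity `…ApexPackageTranslate` / `LocalTypeIReverseZoom`;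
a.e. bound `4` on `]−1/16,0[ × B(0,A_k)` from `Adm(r/4)`, `2C` below by the rate; `SuitableCompactness_holds` on growing
balls; bounds by `LocalTypeILsc*`; top-vanishing by the uniform pairing modulus), a limit IN THE CLASS (some class constants `M', D₀', C'`; the lsc of `𝐈` costs a factor)
which is a.e. bounded on the late whole-space slab `]−1/16, 0[ × ℝ³` and NOT a.e. zero on `Q_3(0)` (the failure of `Adm(2r_k)`
survives the limit through the k-uniform Serrin/Hölder bounds `exists_representative_of_ae_bound_of_local_pressure`). -/
theorem stub_caseOneZoom :
    ∀ (U : ℝ → EuclideanSpace ℝ (Fin 3) → EuclideanSpace ℝ (Fin 3))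
      (P : ℝ → EuclideanSpace ℝ (Fin 3) → ℝ)
      (G : ℝ → EuclideanSpace ℝ (Fin 3) →
        EuclideanSpace ℝ (Fin 3) →L[ℝ] EuclideanSpace ℝ (Fin 3))
      (M D₀ : ℝ≥0) (C : ℝ),
      (∀ a : ℝ, 0 < a →
        IsSuitableWeakSolutionInBall a (0 : ℝ × EuclideanSpace ℝ (Fin 3)) U P) →
      (∀ a : ℝ, 0 < a →
        HasWeakSpatialGradientOn
          (parabolicCylinderOpens a (0 : ℝ × EuclideanSpace ℝ (Fin 3))) U G) →
      (∀ a : ℝ, 0 < a →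
        typeIBound (parabolicCylinder a (0 : ℝ × EuclideanSpace ℝ (Fin 3))) U P G ≤ M) →
      (∀ z₀ : ℝ × EuclideanSpace ℝ (Fin 3), z₀.1 ≤ 0 →
        ∀ r : ℝ, 0 < r → cknD r z₀ P ≤ D₀) →
      (∀ s : ℝ, s < 0 →
        ∀ᵐ y : EuclideanSpace ℝ (Fin 3), ‖U s y‖ ≤ C / Real.sqrt (-s)) →
      (∀ φ : EuclideanSpace ℝ (Fin 3) → EuclideanSpace ℝ (Fin 3),
        ContDiff ℝ (⊤ : ℕ∞) φ →
        HasCompactSupport φ → ∀ ε : ℝ, 0 < ε →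
        ∃ s₀ : ℝ, s₀ < 0 ∧ ∀ᵐ s ∂(volume.restrict (Ioo s₀ 0)), |∫ y, ⟪U s y, φ y⟫| ≤ ε) →
      (∀ A : ℝ, 0 < A → ∃ (yc : EuclideanSpace ℝ (Fin 3)) (r : ℝ), 0 < r ∧ r ≤ 1 / 2 ∧
        (∀ y' ∈ ball yc (A * r),
          ∀ᵐ z ∂(volume.restrict (parabolicCylinder (r / 4) (((0 : ℝ), y') : ℝ × EuclideanSpace ℝ (Fin 3)))),
            ‖U z.1 z.2‖ ≤ (r / 4)⁻¹) ∧
        ¬ (∀ᵐ z ∂(volume.restrict (parabolicCylinder (2 * r) (((0 : ℝ), yc) : ℝ × EuclideanSpace ℝ (Fin 3)))),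
            ‖U z.1 z.2‖ ≤ (2 * r)⁻¹)) →
      ∃ (M' D₀' : ℝ≥0) (C' : ℝ) (V : ℝ → EuclideanSpace ℝ (Fin 3) → EuclideanSpace ℝ (Fin 3))
        (Q : ℝ → EuclideanSpace ℝ (Fin 3) → ℝ)
        (H : ℝ → EuclideanSpace ℝ (Fin 3) →
          EuclideanSpace ℝ (Fin 3) →L[ℝ] EuclideanSpace ℝ (Fin 3)),
      (∀ a : ℝ, 0 < a →
        IsSuitableWeakSolutionInBall a (0 : ℝ × EuclideanSpace ℝ (Fin 3)) V Q) ∧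
      (∀ a : ℝ, 0 < a →
        HasWeakSpatialGradientOn
          (parabolicCylinderOpens a (0 : ℝ × EuclideanSpace ℝ (Fin 3))) V H) ∧
      (∀ a : ℝ, 0 < a →
        typeIBound (parabolicCylinder a (0 : ℝ × EuclideanSpace ℝ (Fin 3))) V Q H ≤ M') ∧
      (∀ z₀ : ℝ × EuclideanSpace ℝ (Fin 3), z₀.1 ≤ 0 →
        ∀ r : ℝ, 0 < r → cknD r z₀ Q ≤ D₀') ∧
      (∀ s : ℝ, s < 0 →
        ∀ᵐ y : EuclideanSpace ℝ (Fin 3), ‖V s y‖ ≤ C' / Real.sqrt (-s)) ∧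
      (∀ φ : EuclideanSpace ℝ (Fin 3) → EuclideanSpace ℝ (Fin 3),
        ContDiff ℝ (⊤ : ℕ∞) φ →
        HasCompactSupport φ → ∀ ε : ℝ, 0 < ε →
        ∃ s₀ : ℝ, s₀ < 0 ∧ ∀ᵐ s ∂(volume.restrict (Ioo s₀ 0)), |∫ y, ⟪V s y, φ y⟫| ≤ ε) ∧
      (∀ᵐ z ∂(volume.restrict (Ioo (-(1 / 16 : ℝ)) 0 ×ˢ (univ : Set (EuclideanSpace ℝ (Fin 3))))),
          ‖V z.1 z.2‖ ≤ 4) ∧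
      ¬ (∀ᵐ z ∂(volume.restrict (parabolicCylinder 3 (0 : ℝ × EuclideanSpace ℝ (Fin 3)))), V z.1 z.2 = 0) := by
  exact caseOneZoom

/-- STUB Z5 «CASE-2 ZOOM PACKAGE» (L): from the CASE-2 data of `stub_radiusDichotomy`, a backward-singular origin and ONE
regular top point, an extinct Type-I apex produces, by zooming at the top singular point `x*` NEAREST to the regular point
(exists: `isClosed_topSingularSet`) along any `λ_k → 0`, a limit IN THE CLASS which is a.e. bounded on a late HALF-SPACE
slab `]−δ,0[ × {⟨y,e⟩ > 1}`, `e = (y₁ − x*)/|y₁ − x*|` (points `x* + λy`, `⟨y,e⟩ = t`, `|y| ≤ R`, `λ < 2td/R²` lie in the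
clean ball with `dist(·, Σ₀) ≥ λt/2`, so CASE 2 gives `Adm(c₀λt/2)` there — uniform regularity of the zooms on
`{⟨y,e⟩ > 1} ∩ B(0,R)`), with top-vanishing (uniform pairing modulus) and NOT a.e. zero on `Q_1(0)` (Seregin's floor
`exists_le_cknC_of_isBackwardSingularPoint` at `x*` at every scale, strong `L³` convergence). -/
theorem stub_caseTwoZoom :
    ∀ (U : ℝ → EuclideanSpace ℝ (Fin 3) → EuclideanSpace ℝ (Fin 3))
      (P : ℝ → EuclideanSpace ℝ (Fin 3) → ℝ)
      (G : ℝ → EuclideanSpace ℝ (Fin 3) →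
        EuclideanSpace ℝ (Fin 3) →L[ℝ] EuclideanSpace ℝ (Fin 3))
      (M D₀ : ℝ≥0) (C : ℝ),
      (∀ a : ℝ, 0 < a →
        IsSuitableWeakSolutionInBall a (0 : ℝ × EuclideanSpace ℝ (Fin 3)) U P) →
      (∀ a : ℝ, 0 < a →
        HasWeakSpatialGradientOn
          (parabolicCylinderOpens a (0 : ℝ × EuclideanSpace ℝ (Fin 3))) U G) →
      (∀ a : ℝ, 0 < a →
        typeIBound (parabolicCylinder a (0 : ℝ × EuclideanSpace ℝ (Fin 3))) U P G ≤ M) →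
      (∀ z₀ : ℝ × EuclideanSpace ℝ (Fin 3), z₀.1 ≤ 0 →
        ∀ r : ℝ, 0 < r → cknD r z₀ P ≤ D₀) →
      (∀ s : ℝ, s < 0 →
        ∀ᵐ y : EuclideanSpace ℝ (Fin 3), ‖U s y‖ ≤ C / Real.sqrt (-s)) →
      (∀ φ : EuclideanSpace ℝ (Fin 3) → EuclideanSpace ℝ (Fin 3),
        ContDiff ℝ (⊤ : ℕ∞) φ →
        HasCompactSupport φ → ∀ ε : ℝ, 0 < ε →
        ∃ s₀ : ℝ, s₀ < 0 ∧ ∀ᵐ s ∂(volume.restrict (Ioo s₀ 0)), |∫ y, ⟪U s y, φ y⟫| ≤ ε) →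
      IsBackwardSingularPoint U (0 : ℝ × EuclideanSpace ℝ (Fin 3)) →
      (∃ y₁ : EuclideanSpace ℝ (Fin 3), ¬ IsBackwardSingularPoint U ((0 : ℝ), y₁)) →
      (∃ c₀ : ℝ, 0 < c₀ ∧ ∀ y : EuclideanSpace ℝ (Fin 3),
        ¬ IsBackwardSingularPoint U ((0 : ℝ), y) →
        ∀ r : ℝ, 0 < r →
          r ≤ c₀ * min (infDist y {x : EuclideanSpace ℝ (Fin 3) | IsBackwardSingularPoint U ((0 : ℝ), x)}) 1 →
          ∀ᵐ z ∂(volume.restrict (parabolicCylinder r (((0 : ℝ), y) : ℝ × EuclideanSpace ℝ (Fin 3)))),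
            ‖U z.1 z.2‖ ≤ r⁻¹) →
      ∃ (M' D₀' : ℝ≥0) (C' : ℝ) (V : ℝ → EuclideanSpace ℝ (Fin 3) → EuclideanSpace ℝ (Fin 3))
        (Q : ℝ → EuclideanSpace ℝ (Fin 3) → ℝ)
        (H : ℝ → EuclideanSpace ℝ (Fin 3) →
          EuclideanSpace ℝ (Fin 3) →L[ℝ] EuclideanSpace ℝ (Fin 3)),
      (∀ a : ℝ, 0 < a →
        IsSuitableWeakSolutionInBall a (0 : ℝ × EuclideanSpace ℝ (Fin 3)) V Q) ∧
      (∀ a : ℝ, 0 < a →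
        HasWeakSpatialGradientOn
          (parabolicCylinderOpens a (0 : ℝ × EuclideanSpace ℝ (Fin 3))) V H) ∧
      (∀ a : ℝ, 0 < a →
        typeIBound (parabolicCylinder a (0 : ℝ × EuclideanSpace ℝ (Fin 3))) V Q H ≤ M') ∧
      (∀ z₀ : ℝ × EuclideanSpace ℝ (Fin 3), z₀.1 ≤ 0 →
        ∀ r : ℝ, 0 < r → cknD r z₀ Q ≤ D₀') ∧
      (∀ s : ℝ, s < 0 →
        ∀ᵐ y : EuclideanSpace ℝ (Fin 3), ‖V s y‖ ≤ C' / Real.sqrt (-s)) ∧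
      (∀ φ : EuclideanSpace ℝ (Fin 3) → EuclideanSpace ℝ (Fin 3),
        ContDiff ℝ (⊤ : ℕ∞) φ →
        HasCompactSupport φ → ∀ ε : ℝ, 0 < ε →
        ∃ s₀ : ℝ, s₀ < 0 ∧ ∀ᵐ s ∂(volume.restrict (Ioo s₀ 0)), |∫ y, ⟪V s y, φ y⟫| ≤ ε) ∧
      (∃ e : EuclideanSpace ℝ (Fin 3), ‖e‖ = 1 ∧ ∃ δ : ℝ, 0 < δ ∧ ∃ K : ℝ,
        ∀ᵐ z ∂(volume.restrict (Ioo (-δ) 0 ×ˢ {y : EuclideanSpace ℝ (Fin 3) | 1 < ⟪y, e⟫})),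
          ‖V z.1 z.2‖ ≤ K) ∧
      ¬ (∀ᵐ z ∂(volume.restrict (parabolicCylinder 1 (0 : ℝ × EuclideanSpace ℝ (Fin 3)))), V z.1 z.2 = 0) := by
  exact caseTwoZoom

/-- A set of `ℝ³` of one-dimensional Hausdorff measure zero is not all of `ℝ³`: the whole space is closed and meets
every shell about the origin, so `μH[1] ℝ³ ≠ 0` (`hausdorffMeasure_ne_zero_of_meets_every_shell`). [folklore] -/
theorem exists_not_mem_of_hausdorffMeasure_one_eq_zero {S : Set (EuclideanSpace ℝ (Fin 3))}
    (hS : μH[1] S = 0) : ∃ y : EuclideanSpace ℝ (Fin 3), y ∉ S := by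
  by_contra h
  simp only [not_exists, not_not] at h
  have huniv : S = univ := eq_univ_of_forall h
  rw [huniv] at hS
  refine hausdorffMeasure_ne_zero_of_meets_every_shell isClosed_univ (0 : EuclideanSpace ℝ (Fin 3)) ?_ hS
  intro R hR _ A hA
  obtain ⟨v, hv⟩ := exists_norm_eq (EuclideanSpace ℝ (Fin 3)) hR.le
  refine ⟨v, mem_univ _, ?_, ?_⟩
  · rw [sub_zero, hv]
  · rw [sub_zero, hv]
    nlinarith

/-! ## The composition (kernel-checked; the only `sorry`s are the five stubs above) -/

/-- **NO EXTINCT TYPE-I APEX IS BACKWARD-SINGULAR AT THE ORIGIN** (from the stubs): by `stub_radiusDichotomy`, either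
CASE 2 — then, the top singular set being `μH[1]`-null (`hausdorffMeasure_topSingular_apex_eq_zero`, CKN at the top) and
hence not all of `ℝ³`, `stub_caseTwoZoom` produces a non-trivial class member bounded on a late half-space slab, which
`stub_halfSpaceLiouville` annihilates — or CASE 1 — then `stub_caseOneZoom` produces a non-trivial class member bounded on
a late whole-space slab, which `stub_lateBoundedLiouville` annihilates. -/
theorem no_singular_extinctApex
    (U : ℝ → EuclideanSpace ℝ (Fin 3) → EuclideanSpace ℝ (Fin 3))
    (P : ℝ → EuclideanSpace ℝ (Fin 3) → ℝ)
    (G : ℝ → EuclideanSpace ℝ (Fin 3) →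
      EuclideanSpace ℝ (Fin 3) →L[ℝ] EuclideanSpace ℝ (Fin 3))
    (M D₀ : ℝ≥0) (C : ℝ)
    (hsw : ∀ a : ℝ, 0 < a →
      IsSuitableWeakSolutionInBall a (0 : ℝ × EuclideanSpace ℝ (Fin 3)) U P)
    (hG : ∀ a : ℝ, 0 < a →
      HasWeakSpatialGradientOn
        (parabolicCylinderOpens a (0 : ℝ × EuclideanSpace ℝ (Fin 3))) U G)
    (hI : ∀ a : ℝ, 0 < a →
      typeIBound (parabolicCylinder a (0 : ℝ × EuclideanSpace ℝ (Fin 3))) U P G ≤ M)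
    (hD : ∀ z₀ : ℝ × EuclideanSpace ℝ (Fin 3), z₀.1 ≤ 0 →
      ∀ r : ℝ, 0 < r → cknD r z₀ P ≤ D₀)
    (hrate : ∀ s : ℝ, s < 0 →
      ∀ᵐ y : EuclideanSpace ℝ (Fin 3), ‖U s y‖ ≤ C / Real.sqrt (-s))
    (htop : ∀ φ : EuclideanSpace ℝ (Fin 3) → EuclideanSpace ℝ (Fin 3),
      ContDiff ℝ (⊤ : ℕ∞) φ →
      HasCompactSupport φ → ∀ ε : ℝ, 0 < ε →
      ∃ s₀ : ℝ, s₀ < 0 ∧ ∀ᵐ s ∂(volume.restrict (Ioo s₀ 0)), |∫ y, ⟪U s y, φ y⟫| ≤ ε) :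
    ¬ IsBackwardSingularPoint U (0 : ℝ × EuclideanSpace ℝ (Fin 3)) := by
  intro hsing
  rcases stub_radiusDichotomy U with ⟨c₀, hc₀, hcase2⟩ | hcase1
  · -- CASE 2: a regular top point exists by CKN at the top
    obtain ⟨y₁, hy₁⟩ := exists_not_mem_of_hausdorffMeasure_one_eq_zero
      (hausdorffMeasure_topSingular_apex_eq_zero hsw)
    obtain ⟨M', D₀', C', V, Q, H, hV, hH, hIV, hDV, hrV, htV, hhalf, hne⟩ :=
      stub_caseTwoZoom U P G M D₀ C hsw hG hI hD hrate htop hsing ⟨y₁, hy₁⟩ ⟨c₀, hc₀, hcase2⟩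
    exact hne (stub_halfSpaceLiouville V Q H M' D₀' C' hV hH hIV hDV hrV htV hhalf 1 one_pos)
  · -- CASE 1
    obtain ⟨M', D₀', C', V, Q, H, hV, hH, hIV, hDV, hrV, htV, hlate, hne⟩ :=
      stub_caseOneZoom U P G M D₀ C hsw hG hI hD hrate htop hcase1
    exact hne (stub_lateBoundedLiouville V Q H M' D₀' C' hV hH hIV hDV hrV htV
      ⟨1 / 16, by norm_num, 4, hlate⟩ 3 (by norm_num))

/-- The registered LOUD stub of skeleton v4 (`stub_no_loudShellExtinctApex`, VERBATIM signature) follows — its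
quiet-shell-exclusion and loudness hypotheses are not even used. -/
theorem stub_no_loudShellExtinctApex_of_stubs :
    ∀ (M D₀ : ℝ≥0) (C A₀ : ℝ), 1 < A₀ →
    (∀ (U : ℝ → EuclideanSpace ℝ (Fin 3) → EuclideanSpace ℝ (Fin 3))
      (P : ℝ → EuclideanSpace ℝ (Fin 3) → ℝ)
      (G : ℝ → EuclideanSpace ℝ (Fin 3) →
        EuclideanSpace ℝ (Fin 3) →L[ℝ] EuclideanSpace ℝ (Fin 3)),
      (∀ a : ℝ, 0 < a →
        IsSuitableWeakSolutionInBall a (0 : ℝ × EuclideanSpace ℝ (Fin 3)) U P) →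
      (∀ a : ℝ, 0 < a →
        HasWeakSpatialGradientOn
          (parabolicCylinderOpens a (0 : ℝ × EuclideanSpace ℝ (Fin 3))) U G) →
      (∀ a : ℝ, 0 < a →
        typeIBound (parabolicCylinder a (0 : ℝ × EuclideanSpace ℝ (Fin 3))) U P G ≤ M) →
      (∀ z₀ : ℝ × EuclideanSpace ℝ (Fin 3), z₀.1 ≤ 0 →
        ∀ r : ℝ, 0 < r → cknD r z₀ P ≤ D₀) →
      (∀ s : ℝ, s < 0 →
        ∀ᵐ y : EuclideanSpace ℝ (Fin 3), ‖U s y‖ ≤ C / Real.sqrt (-s)) →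
      (∀ φ : EuclideanSpace ℝ (Fin 3) → EuclideanSpace ℝ (Fin 3),
        ContDiff ℝ (⊤ : ℕ∞) φ →
        HasCompactSupport φ → ∀ ε : ℝ, 0 < ε →
        ∃ s₀ : ℝ, s₀ < 0 ∧ ∀ᵐ s ∂(volume.restrict (Ioo s₀ 0)), |∫ y, ⟪U s y, φ y⟫| ≤ ε) →
      (∃ δ : ℝ, 0 < δ ∧ ∃ R : ℝ, 0 < R ∧ ∃ K : ℝ,
        ∀ᵐ z ∂(volume.restrict
          (Ioo (-δ) 0 ×ˢ {y : EuclideanSpace ℝ (Fin 3) | R < ‖y‖ ∧ ‖y‖ < A₀ * R})),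
            ‖U z.1 z.2‖ ≤ K) →
      ¬ IsBackwardSingularPoint U (0 : ℝ × EuclideanSpace ℝ (Fin 3))) →
    ∀ (U : ℝ → EuclideanSpace ℝ (Fin 3) → EuclideanSpace ℝ (Fin 3))
      (P : ℝ → EuclideanSpace ℝ (Fin 3) → ℝ)
      (G : ℝ → EuclideanSpace ℝ (Fin 3) →
        EuclideanSpace ℝ (Fin 3) →L[ℝ] EuclideanSpace ℝ (Fin 3)),
      (∀ a : ℝ, 0 < a →
        IsSuitableWeakSolutionInBall a (0 : ℝ × EuclideanSpace ℝ (Fin 3)) U P) →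
      (∀ a : ℝ, 0 < a →
        HasWeakSpatialGradientOn
          (parabolicCylinderOpens a (0 : ℝ × EuclideanSpace ℝ (Fin 3))) U G) →
      (∀ a : ℝ, 0 < a →
        typeIBound (parabolicCylinder a (0 : ℝ × EuclideanSpace ℝ (Fin 3))) U P G ≤ M) →
      (∀ z₀ : ℝ × EuclideanSpace ℝ (Fin 3), z₀.1 ≤ 0 →
        ∀ r : ℝ, 0 < r → cknD r z₀ P ≤ D₀) →
      (∀ s : ℝ, s < 0 →
        ∀ᵐ y : EuclideanSpace ℝ (Fin 3), ‖U s y‖ ≤ C / Real.sqrt (-s)) →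
      (∀ φ : EuclideanSpace ℝ (Fin 3) → EuclideanSpace ℝ (Fin 3),
        ContDiff ℝ (⊤ : ℕ∞) φ →
        HasCompactSupport φ → ∀ ε : ℝ, 0 < ε →
        ∃ s₀ : ℝ, s₀ < 0 ∧ ∀ᵐ s ∂(volume.restrict (Ioo s₀ 0)), |∫ y, ⟪U s y, φ y⟫| ≤ ε) →
      (¬ ∃ δ : ℝ, 0 < δ ∧ ∃ R : ℝ, 0 < R ∧ ∃ K : ℝ,
        ∀ᵐ z ∂(volume.restrict
          (Ioo (-δ) 0 ×ˢ {y : EuclideanSpace ℝ (Fin 3) | R < ‖y‖ ∧ ‖y‖ < A₀ * R})),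
            ‖U z.1 z.2‖ ≤ K) →
      ¬ IsBackwardSingularPoint U (0 : ℝ × EuclideanSpace ℝ (Fin 3)) :=
  fun M D₀ C _A₀ _ _ U P G hsw hG hI hD hrate htop _ =>
    no_singular_extinctApex U P G M D₀ C hsw hG hI hD hrate htop

/-- **THE ITEM BY NAME from the five stubs** (kernel-checked): Stub C of line `apex-dichotomy` holds with its SPREAD
hypothesis unused, and the landed `typeITraceScarL3_of_no_spreadExtinctApex` (p585751) concludes. -/
theorem TypeITraceScarL3_of_stubs :
    Summit.NavierStokesRegularity.NavierStokesRegularity.Theses.TerminalTrace.TypeITraceScarL3 :=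
  typeITraceScarL3_of_no_spreadExtinctApex fun U P G M D₀ C hsw hG hI hD hrate htop _ =>
    no_singular_extinctApex U P G M D₀ C hsw hG hI hD hrate htop

end Summit.NavierStokesRegularity.NavierStokesRegularity.Cruxes.TypeITraceScarL3.RadiusDichotomy

end
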